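import Literature.AlgebraicGeometry.Motives.GoodReductionProofs
import HarnessLib

/-!
# Spreading out WITHOUT geometric irreducibility: smooth proper models of a smooth projective scheme outside finitely many places
# (EGA IV₃ 8.10.5, IV₄ 17.7.8; Stacks 01ZM, 0C0C, 081F — the projective-closure argument)

Topic `Literature/AlgebraicGeometry/Motives`, namespace `Literature.AlgebraicGeometry.Motives`.  THEOREMS ONLY (no definition, no named
fact, no instance, no `sorry`).  Cell `hodgecm-mathlib` (D-0151), FLOOR 0, programme F0P5a (D9op road 2′, crux item
stmt-HodgeConjecture-24832): generic trunk piece **T1** of the L3a pole (census `F0/P5a/L3a-POLE-census.v0.1.F0P5a-p02g0.md`; LEAD WORD #3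
(Q2) «binder-free spreading out»).

The tree's ★ `exists_finite_forall_exists_integralModel` / `exists_finite_hasGoodReductionOutside_holds` (`Motives/GoodReductionProofs.lean`)
are stated for `IsSmoothProjective n X`, whose third clause is `GeometricallyIrreducible X.hom`; but the projective-closure proof printed there
(scheme-theoretic image of `X ↪ ℙᴺ_K → ℙᴺ_A`, the open locus where the closure is smooth of relative dimension `n` contains the generic
fibre, properness pushes the bad locus onto finitely many closed points) uses ONLY smoothness of relative dimension `n` and a closed
immersion into `ℙᴺ_K`.  The record unitary Shimura curve `M⋆_K` of [Liu2021] App. C/D is smooth and projective over the CM field but NOT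
geometrically irreducible (its complex fibre has `#(U(J⋆)(L⁺)∖U(J⋆)(𝔸_f)/K)` components), so the pole needs the statement without that
binder.  This file re-runs the SAME proof (token for token, the tree's own argument and helper lemmas) under the weaker hypotheses:

* `exists_finite_forall_exists_integralModel_of_isProjectiveOver` — over a Dedekind domain `A` with fraction field `K`: a `K`-scheme `X`
  smooth of relative dimension `n` and projective over `K` has, for all but finitely many nonzero primes `v` of `A`, an integral model over
  `A_v = valuationSubringAtPrime K v` which is smooth of relative dimension `n` and proper;
* `exists_finite_forall_hasGoodReductionAt_of_isProjectiveOver` — the number-field reading: `HasGoodReductionAt X n v` for all `v` outside a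
  finite set of finite places.

HC_CM is proved only modulo the 7 printed citations until rung 0 closes; this file is a generic leaf and changes no count.

## References
* [StacksProject] Tags 01ZM, 0C0C, 081F (limits of schemes / spreading out), 01R8 (scheme-theoretic image), 01WC (projective ⇒ proper).
* [SerreTate1968] J.-P. Serre, J. Tate, *Good reduction of abelian varieties*, Ann. of Math. 88 (1968), §1 (the projective-closure model).
-/

noncomputable section

open CategoryTheory AlgebraicGeometry Limits IsDedekindDomain

universe u

namespace Literature.AlgebraicGeometry.Motives

section Model

open IsDedekindDomain.HeightOneSpectrum

variable {A K : Type u} [CommRing A] [IsDedekindDomain A] [Field K] [Algebra A K]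
  [IsFractionRing A K] {n : ℕ} {X : SchemeOver K}

/-- **Spreading out a smooth projective scheme over a Dedekind domain — no irreducibility hypothesis.** Let `A` be a Dedekind domain
with fraction field `K` and `X` a `K`-scheme smooth of relative dimension `n` admitting a closed `K`-immersion into some `ℙᴺ_K`. Then for
all but finitely many nonzero primes `v` of `A`, `X` has an integral model over the local ring `A_v ⊆ K` which is smooth of relative
dimension `n` and proper.  Proof = the tree's ★ `exists_finite_forall_exists_integralModel` verbatim (projective closure in `ℙᴺ_A`, open
smooth locus containing the generic fibre, properness), which never used the `GeometricallyIrreducible` clause of `IsSmoothProjective`.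
[cite: StacksProject, Tags 01ZM, 0C0C and 081F (spreading out; here via the projective closure)] -/
theorem exists_finite_forall_exists_integralModel_of_isProjectiveOver [SmoothOfRelativeDimension n X.hom]
    (hX : IsProjectiveOver X) :
    ∃ S : Set (HeightOneSpectrum A), S.Finite ∧ ∀ v ∉ S,
      ∃ 𝒳 : IntegralModel (valuationSubringAtPrime K v) K X, 𝒳.IsSmoothProper n := by
  classical
  haveI : Module.Flat A K := IsLocalization.flat K (nonZeroDivisors A)
  obtain ⟨N, ι, hι⟩ := hX
  -- the graded-algebra and base-algebra structures used by the tree's projective-space lemmas (local to this proof)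
  letI : GradedAlgebra (MvPolynomial.homogeneousSubmodule (Fin (N + 1)) K) := MvPolynomial.gradedAlgebra
  letI : GradedAlgebra (MvPolynomial.homogeneousSubmodule (Fin (N + 1)) A) := MvPolynomial.gradedAlgebra
  letI : ∀ x : Submonoid (MvPolynomial (Fin (N + 1)) A),
      Algebra A (HomogeneousLocalization (MvPolynomial.homogeneousSubmodule (Fin (N + 1)) A) x) :=
    fun x => ProjBaseChange.algebraBase _ x
  letI : ∀ x : Submonoid (MvPolynomial (Fin (N + 1)) K),
      Algebra K (HomogeneousLocalization (MvPolynomial.homogeneousSubmodule (Fin (N + 1)) K) x) :=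
    fun x => ProjBaseChange.algebraBase _ x
  -- (the target of `ι.left` is `ℙᴺ_K = Proj K[x₀,…,x_N]`; we restate the instance with the
  -- unfolded target so that instance resolution finds it)
  haveI : @IsClosedImmersion X.left (Proj (MvPolynomial.homogeneousSubmodule (Fin (N + 1)) K))
      ι.left := hι
  -- the base change `Spec K → Spec A`
  set i : Spec (.of K) ⟶ Spec (.of A) := Spec.map (CommRingCat.ofHom (algebraMap A K)) with hi
  haveI : Flat i := Motives.flat_specMap_of_isLocalization A K (nonZeroDivisors A)
  haveI : Mono i := Motives.mono_specMap_of_isLocalization A K (nonZeroDivisors A)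
  haveI : SurjectiveOnStalks i := SurjectiveOnStalks.Spec_iff.mpr
    (RingHom.surjectiveOnStalks_of_isLocalization (M := nonZeroDivisors A) K)
  -- projective spaces
  set pA := ProjBaseChangeRing.projToSpec (Fin (N + 1)) A
  set pK := ProjBaseChangeRing.projToSpec (Fin (N + 1)) K
  set φ := Proj.map (ProjBaseChangeRing.mapGraded A K (Fin (N + 1)))
    (ProjBaseChangeRing.irrelevant_le_map A K (Fin (N + 1)))
  have hP : IsPullback φ pK pA i := ProjBaseChangeRing.isPullback_projMap A K (Fin (N + 1))
  haveI : QuasiCompact φ := MorphismProperty.of_isPullback hP.flip inferInstance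
  have hιw : ι.left ≫ pK = X.hom := Over.w ι
  -- the model over `A`: the scheme-theoretic image of `X → ℙᴺ_K → ℙᴺ_A`
  set g := ι.left ≫ φ
  set f : g.image ⟶ Spec (.of A) := g.imageι ≫ pA
  have Hgen : IsPullback g.toImage X.hom f i :=
    Motives.isPullback_toImage_of_flat_mono i pA pK φ hP _ X.hom hιw
  haveI : IsProper pA := ProjBaseChangeRing.isProper_projToSpec (Fin (N + 1)) A
  haveI : IsProper f := inferInstance
  haveI : LocallyOfFinitePresentation f := inferInstance
  -- the good locus `W` (where `f` is smooth of relative dimension `n`) contains the generic fibre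
  set η : Spec (.of A) := ⟨⊥, Ideal.isPrime_bot⟩
  set pt : Spec (.of K) := ⟨⊥, Ideal.isPrime_bot⟩
  have hipt : i pt = η := by
    rw [hi, Spec.map_apply]
    exact PrimeSpectrum.ext (Ideal.comap_bot_of_injective _ (IsFractionRing.injective A K))
  set W : g.image.Opens := sSup {V | SmoothOfRelativeDimension n (V.ι ≫ f)}
  have hWs : SmoothOfRelativeDimension n (W.ι ≫ f) :=
    Motives.smoothOfRelativeDimension_sSup_ι_comp n f _ fun V hV ↦ hV
  have hgen : ∀ x : g.image, f x = η → x ∈ W := fun x hx ↦ by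
    obtain ⟨V, hV, hxV⟩ := Motives.exists_smoothOfRelativeDimension_ι_comp_of_isPullback n Hgen
      x pt (hx.trans hipt.symm)
    exact (le_sSup hV : V ≤ W) hxV
  -- the bad set: the image of the complement of `W`, a closed set missing the generic point
  set C : Set (Spec (.of A)) := ⇑f '' (W : Set g.image)ᶜ
  have hCc : IsClosed C := f.isClosedMap _ W.isOpen.isClosed_compl
  have hηC : η ∉ C := by
    rintro ⟨x, hx, hxη⟩
    exact hx (hgen x hxη)
  refine ⟨{v | (⟨v.asIdeal, v.isPrime⟩ : PrimeSpectrum A) ∈ C},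
    HeightOneSpectrum.finite_setOf_mem_of_isClosed hCc hηC, fun v hv ↦ ?_⟩
  -- the model at a good prime `v`: base change to `A_v = valuationSubringAtPrime K v`
  set Ov := valuationSubringAtPrime K v
  set t : Spec (.of Ov) ⟶ Spec (.of A) := Spec.map (CommRingCat.ofHom (algebraMap A Ov))
  let M : SchemeOver A := Over.mk f
  let Mv : SchemeOver (Ov : Type u) := (baseChange A (Ov : Type u)).obj M
  have HMv : IsPullback (pullback.fst f t) Mv.hom f t := IsPullback.of_hasPullback f t
  have hrange : Set.range ⇑(pullback.fst f t) ⊆ (W : Set g.image) := by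
    rintro _ ⟨z, rfl⟩
    by_contra hz
    have hmem : f (pullback.fst f t z) ∈ C := ⟨_, hz, rfl⟩
    have hft : f (pullback.fst f t z) = t (pullback.snd f t z) := by
      rw [← Scheme.Hom.comp_apply, pullback.condition, Scheme.Hom.comp_apply]
    rw [hft] at hmem
    rcases HeightOneSpectrum.specMap_apply_eq_or A v (pullback.snd f t z) with h | h
    · rw [h] at hmem
      exact hηC hmem
    · rw [h] at hmem
      exact hv hmem
  have hsmooth : SmoothOfRelativeDimension n Mv.hom :=
    Motives.smoothOfRelativeDimension_of_range_subset hWs HMv hrange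
  have hproper : IsProper Mv.hom := MorphismProperty.baseChange_obj _ _ ‹IsProper f›
  -- the generic fibre: `(𝒳 ×_A A_v) ×_{A_v} K ≅ 𝒳 ×_A K ≅ X` (pullback pasting, Mathlib
  -- `Over.pullbackComp`, and the cartesian square `Hgen`)
  have hcomp : (algebraMap (Ov : Type u) K).comp (algebraMap A Ov) = algebraMap A K :=
    (IsScalarTower.algebraMap_eq A Ov K).symm
  let eComp : baseChange A (Ov : Type u) ⋙ baseChange (Ov : Type u) K ≅ baseChange A K :=
    (Over.pullbackComp (Spec.map (CommRingCat.ofHom (algebraMap (Ov : Type u) K)))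
      (Spec.map (CommRingCat.ofHom (algebraMap A Ov)))).symm ≪≫ eqToIso (by
        change Over.pullback _ = Over.pullback _
        congr 1
        rw [← Spec.map_comp, ← CommRingCat.ofHom_comp, hcomp])
  let eK : (baseChange A K).obj M ≅ X :=
    (Over.isoMk Hgen.isoPullback Hgen.isoPullback_hom_snd :
      X ≅ Over.mk (pullback.snd f i)).symm
  let e : (baseChange (Ov : Type u) K).obj Mv ≅ X := eComp.app M ≪≫ eK
  exact ⟨⟨Mv, e⟩, hsmooth, hproper⟩

end Model

/-! ### Number fields -/

section NumberField

open scoped NumberField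

variable {K : Type} [Field K] [NumberField K] {X : SchemeOver K} {n : ℕ}

/-- **Good reduction outside a finite set, without geometric irreducibility**: a `K`-scheme smooth of relative dimension `n` and
projective over a number field `K` has a smooth proper model over `𝓞_{K,v}` (`HasGoodReductionAt X n v`) for all finite places `v`
outside a finite set.  Use (F0P5a T1): the record unitary Shimura curve `M⋆_K` (smooth of relative dimension `1`, projective, several
geometric components). [cite: StacksProject, Tags 01ZM, 0C0C and 081F (spreading out / limits of schemes)] -/
theorem exists_finite_forall_hasGoodReductionAt_of_isProjectiveOver [SmoothOfRelativeDimension n X.hom]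
    (hX : IsProjectiveOver X) :
    ∃ S : Set (HeightOneSpectrum (𝓞 K)), S.Finite ∧ ∀ v ∉ S, HasGoodReductionAt X n v := by
  obtain ⟨S, hS, h⟩ := exists_finite_forall_exists_integralModel_of_isProjectiveOver (A := 𝓞 K) (n := n) hX
  exact ⟨S, hS, fun v hv ↦ h v hv⟩

end NumberField

end Literature.AlgebraicGeometry.Motives

end
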